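import Summits.MatrixMultiplication.MatrixMultiplication.Theorems.ObstructionDescentCasimirCount

/- `set_option linter.dupNamespace false` as in the sibling kernel files (namespace `…Theorems.<FileStem>`). -/
set_option linter.dupNamespace false

/-!
# Pair-exchange relations kill three-slot coefficient tensors with `d ≥ 3N − 2` slots (decomp-mm · lens 3 · gen 23, part 2)

Context: route `route-MatrixMultiplication-ObstructionDescent` (`ω(ℂ) = 2`), attacked leaf
`E = NoPolyDegreeObstruction` (item 30889), DEGREE axis.  The aside `GapOneEquationsVanish` (item 27778) says
`I_d(σ_{d-1}(ℂ^N ⊗ ℂ^N ⊗ ℂ^N)) = 0` for `d ≥ 3N − 2`.  Its proof has two halves: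
(polarisation) the symmetric coefficient tensor `G` of a degree-`d` form vanishing on all tensors of rank `< d`
satisfies, for every pair of slots `i ≠ j`, the PAIR-EXCHANGE RELATION
`G + X_{ij} G + Y_{ij} G + Z_{ij} G = 0` (`X`, `Y`, `Z` = the transposition `(i j)` acting on the first, second,
third letters of the slots only); (Casimir) such a `G` is zero once `d ≥ 3N − 2`, `N ≥ 2`.

This module proves the Casimir half (`pairExchange_eq_zero_real`, `pairExchange_eq_zero`): summing the relations
against `G` gives `Σ_{i≠j} ⟨G, (X+Y+Z)_{ij} G⟩ = −d(d−1) ‖G‖²` (`SA_add_SB_add_SC`), while part 1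
(`ObstructionDescentCasimirCount.key_ineq`) bounds each slot group below by `(d² − dN²)/N · ‖G‖²`; for
`d ≥ 3N − 2` the two are incompatible unless `G = 0` (the coefficient is `d((N+3)d − N(3N+1)) > 0`).
`pairExchange_of_polar` records that for a diagonally symmetric `G` the eight-term relation
`(1+X)(1+Y)(1+Z)G = 0` (what polarising `F(x, x, ·) = 0`, `x` of rank one, literally gives) is twice the
four-term relation.

References: Landsberg–Manivel, Found. Comput. Math. 4 (2004) Lemma 3.1 / Cor. 3.4 (prolongation);
Landsberg, *Geometry and Complexity Theory* (2017) Prop. 8.3.4.1.  The Casimir/content argument is this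
cell's (NODE-g23, Theorems A/B).
-/

namespace Summit.MatrixMultiplication.MatrixMultiplication.Theorems.ObstructionDescentPairCasimir

open Finset ObstructionDescentCasimirCount

variable {N d : ℕ}

/-! ## §3 Three slot groups: the pair-exchange relations -/

section ThreeGroups

variable (G : Word N d → Word N d → Word N d → ℝ)

/-- `‖G‖²` as an iterated sum. [folklore] -/
def total : ℝ := ∑ α, ∑ β, ∑ γ, G α β γ ^ 2

/-- `Σ_{i≠j} ⟨G, X_{ij} G⟩`, fibred over the second and third slot groups. [this cell] -/
def SA : ℝ := ∑ v : Word N d × Word N d, exchSum (fun α => G α v.1 v.2)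

/-- `Σ_{i≠j} ⟨G, Y_{ij} G⟩`. [this cell] -/
def SB : ℝ := ∑ v : Word N d × Word N d, exchSum (fun β => G v.1 β v.2)

/-- `Σ_{i≠j} ⟨G, Z_{ij} G⟩`. [this cell] -/
def SC : ℝ := ∑ v : Word N d × Word N d, exchSum (fun γ => G v.1 v.2 γ)

/-- The content bound for the first slot group. [this cell] -/
theorem SA_bound : ((d : ℝ) ^ 2 - d * N ^ 2) * total G ≤ N * SA G := by
  have h : ((d : ℝ) ^ 2 - d * N ^ 2) * ∑ v : Word N d × Word N d, normSq (fun α => G α v.1 v.2)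
      ≤ N * SA G := by
    rw [SA, Finset.mul_sum, Finset.mul_sum]
    exact Finset.sum_le_sum fun v _ => key_ineq _
  have e : ∑ v : Word N d × Word N d, normSq (fun α => G α v.1 v.2) = total G := by
    rw [Fintype.sum_prod_type, total]
    conv_rhs => rw [Finset.sum_comm]
    refine Finset.sum_congr rfl fun β _ => ?_
    simp only [normSq]
    rw [Finset.sum_comm]
  rw [← e]
  exact h

/-- The content bound for the second slot group. [this cell] -/
theorem SB_bound : ((d : ℝ) ^ 2 - d * N ^ 2) * total G ≤ N * SB G := by
  have h : ((d : ℝ) ^ 2 - d * N ^ 2) * ∑ v : Word N d × Word N d, normSq (fun β => G v.1 β v.2)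
      ≤ N * SB G := by
    rw [SB, Finset.mul_sum, Finset.mul_sum]
    exact Finset.sum_le_sum fun v _ => key_ineq _
  have e : ∑ v : Word N d × Word N d, normSq (fun β => G v.1 β v.2) = total G := by
    rw [Fintype.sum_prod_type, total]
    refine Finset.sum_congr rfl fun α _ => ?_
    rw [Finset.sum_comm]
    rfl
  rw [← e]
  exact h

/-- The content bound for the third slot group. [this cell] -/
theorem SC_bound : ((d : ℝ) ^ 2 - d * N ^ 2) * total G ≤ N * SC G := by
  have h : ((d : ℝ) ^ 2 - d * N ^ 2) * ∑ v : Word N d × Word N d, normSq (fun γ => G v.1 v.2 γ)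
      ≤ N * SC G := by
    rw [SC, Finset.mul_sum, Finset.mul_sum]
    exact Finset.sum_le_sum fun v _ => key_ineq _
  have e : ∑ v : Word N d × Word N d, normSq (fun γ => G v.1 v.2 γ) = total G := by
    rw [Fintype.sum_prod_type, total]
    rfl
  rw [← e]
  exact h

/-- Summing the pair-exchange relations against `G`: `SA + SB + SC = −d(d−1)·‖G‖²`. [this cell, NODE-g23 Thm B] -/
theorem SA_add_SB_add_SC
    (hpair : ∀ i j : Fin d, i ≠ j → ∀ α β γ : Word N d,
      G α β γ + G (α ∘ ⇑(Equiv.swap i j)) β γ + G α (β ∘ ⇑(Equiv.swap i j)) γ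
        + G α β (γ ∘ ⇑(Equiv.swap i j)) = 0) :
    SA G + SB G + SC G = -(((d : ℝ) * d - d) * total G) := by
  -- bring the three sums to the common shape `Σ_p Σ_α Σ_β Σ_γ`
  have eA : SA G = ∑ p : Fin d × Fin d, ∑ α, ∑ β, ∑ γ,
      (if p.1 = p.2 then 0 else G α β γ * G (α ∘ ⇑(Equiv.swap p.1 p.2)) β γ) := by
    rw [SA]
    simp only [exchSum]
    rw [Finset.sum_comm]
    refine Finset.sum_congr rfl fun p _ => ?_
    rw [Finset.sum_comm]
    refine Finset.sum_congr rfl fun α _ => ?_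
    rw [Fintype.sum_prod_type]
  have eB : SB G = ∑ p : Fin d × Fin d, ∑ α, ∑ β, ∑ γ,
      (if p.1 = p.2 then 0 else G α β γ * G α (β ∘ ⇑(Equiv.swap p.1 p.2)) γ) := by
    rw [SB]
    simp only [exchSum]
    rw [Finset.sum_comm]
    refine Finset.sum_congr rfl fun p _ => ?_
    rw [Fintype.sum_prod_type]
    refine Finset.sum_congr rfl fun α _ => ?_
    rw [Finset.sum_comm]
  have eC : SC G = ∑ p : Fin d × Fin d, ∑ α, ∑ β, ∑ γ,
      (if p.1 = p.2 then 0 else G α β γ * G α β (γ ∘ ⇑(Equiv.swap p.1 p.2))) := by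
    rw [SC]
    simp only [exchSum]
    rw [Finset.sum_comm]
    refine Finset.sum_congr rfl fun p _ => ?_
    rw [Fintype.sum_prod_type]
  rw [eA, eB, eC, ← Finset.sum_add_distrib, ← Finset.sum_add_distrib]
  have hp : ∀ p : Fin d × Fin d,
      ((∑ α, ∑ β, ∑ γ, (if p.1 = p.2 then 0 else G α β γ * G (α ∘ ⇑(Equiv.swap p.1 p.2)) β γ))
        + (∑ α, ∑ β, ∑ γ, (if p.1 = p.2 then 0 else G α β γ * G α (β ∘ ⇑(Equiv.swap p.1 p.2)) γ)))
        + (∑ α, ∑ β, ∑ γ, (if p.1 = p.2 then 0 else G α β γ * G α β (γ ∘ ⇑(Equiv.swap p.1 p.2))))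
      = if p.1 = p.2 then 0 else -total G := by
    rintro ⟨i, j⟩
    by_cases hij : i = j
    · simp [hij]
    · simp only [if_neg hij, ← Finset.sum_add_distrib, total, ← Finset.sum_neg_distrib]
      refine Finset.sum_congr rfl fun α _ => Finset.sum_congr rfl fun β _ =>
        Finset.sum_congr rfl fun γ _ => ?_
      have h := hpair i j hij α β γ
      have h' : G (α ∘ ⇑(Equiv.swap i j)) β γ + G α (β ∘ ⇑(Equiv.swap i j)) γ
          + G α β (γ ∘ ⇑(Equiv.swap i j)) = -G α β γ := by linarith
      rw [← mul_add, ← mul_add, h']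
      ring
  simp_rw [hp]
  rw [Fintype.sum_prod_type]
  have : ∀ i : Fin d, ∑ j : Fin d, (if i = j then (0 : ℝ) else -total G) = -total G * d + total G := by
    intro i
    have e : ∀ j : Fin d, (if i = j then (0 : ℝ) else -total G) = -total G + if i = j then total G else 0 := by
      intro j; split_ifs <;> ring
    simp_rw [e]
    rw [Finset.sum_add_distrib, Finset.sum_const, card_univ, Fintype.card_fin, nsmul_eq_mul,
      Finset.sum_ite_eq, if_pos (mem_univ _)]
    ring
  simp_rw [this]
  rw [Finset.sum_const, card_univ, Fintype.card_fin, nsmul_eq_mul]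
  ring

/-- MAIN THEOREM (real form).  A real three-slot-group coefficient tensor on `d ≥ 3N − 2` slots (`N ≥ 2`)
satisfying the pair-exchange relation `G + X_{ij}G + Y_{ij}G + Z_{ij}G = 0` for every pair of slots is zero.
[this cell, NODE-g23 Thm B (Casimir half)] -/
theorem pairExchange_eq_zero_real (hN : 2 ≤ N) (hd : 3 * N ≤ d + 2)
    (hpair : ∀ i j : Fin d, i ≠ j → ∀ α β γ : Word N d,
      G α β γ + G (α ∘ ⇑(Equiv.swap i j)) β γ + G α (β ∘ ⇑(Equiv.swap i j)) γ
        + G α β (γ ∘ ⇑(Equiv.swap i j)) = 0) :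
    G = 0 := by
  have hA := SA_bound G
  have hB := SB_bound G
  have hC := SC_bound G
  have hS := SA_add_SB_add_SC G hpair
  have hN' : (2 : ℝ) ≤ N := by exact_mod_cast hN
  have hd' : 3 * (N : ℝ) ≤ d + 2 := by exact_mod_cast hd
  have htot_nonneg : 0 ≤ total G :=
    Finset.sum_nonneg fun _ _ => Finset.sum_nonneg fun _ _ => Finset.sum_nonneg fun _ _ => sq_nonneg _
  -- the coefficient `d((N+3)d − N(3N+1))` is positive
  have hdpos : (0 : ℝ) < d := by linarith
  have hinner : (0 : ℝ) < (N + 3) * d - 3 * N ^ 2 - N := by nlinarith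
  have hcoef : 0 < 3 * ((d : ℝ) ^ 2 - d * N ^ 2) + N * (d * d - d) := by
    have e : 3 * ((d : ℝ) ^ 2 - d * N ^ 2) + N * (d * d - d) = d * ((N + 3) * d - 3 * N ^ 2 - N) := by ring
    rw [e]
    exact mul_pos hdpos hinner
  have htot : total G ≤ 0 := by
    by_contra h
    push Not at h
    nlinarith
  have htot0 : total G = 0 := le_antisymm htot htot_nonneg
  funext α β γ
  have h1 : G α β γ ^ 2 ≤ total G := by
    rw [total]
    refine le_trans ?_ (Finset.single_le_sum (f := fun α' => ∑ β', ∑ γ', G α' β' γ' ^ 2)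
      (fun _ _ => Finset.sum_nonneg fun _ _ => Finset.sum_nonneg fun _ _ => sq_nonneg _) (mem_univ α))
    refine le_trans ?_ (Finset.single_le_sum (f := fun β' => ∑ γ', G α β' γ' ^ 2)
      (fun _ _ => Finset.sum_nonneg fun _ _ => sq_nonneg _) (mem_univ β))
    exact Finset.single_le_sum (f := fun γ' => G α β γ' ^ 2) (fun _ _ => sq_nonneg _) (mem_univ γ)
  rw [htot0] at h1
  exact pow_eq_zero_iff (two_ne_zero) |>.1 (le_antisymm h1 (sq_nonneg _))

end ThreeGroups

/-- MAIN THEOREM (complex form): the same for complex coefficient tensors (real and imaginary parts).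
[this cell, NODE-g23 Thm B (Casimir half)] -/
theorem pairExchange_eq_zero (hN : 2 ≤ N) (hd : 3 * N ≤ d + 2)
    (G : Word N d → Word N d → Word N d → ℂ)
    (hpair : ∀ i j : Fin d, i ≠ j → ∀ α β γ : Word N d,
      G α β γ + G (α ∘ ⇑(Equiv.swap i j)) β γ + G α (β ∘ ⇑(Equiv.swap i j)) γ
        + G α β (γ ∘ ⇑(Equiv.swap i j)) = 0) :
    G = 0 := by
  have hre := pairExchange_eq_zero_real (fun α β γ => (G α β γ).re) hN hd (fun i j hij α β γ => by
    have h := congrArg Complex.re (hpair i j hij α β γ)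
    simpa using h)
  have him := pairExchange_eq_zero_real (fun α β γ => (G α β γ).im) hN hd (fun i j hij α β γ => by
    have h := congrArg Complex.im (hpair i j hij α β γ)
    simpa using h)
  funext α β γ
  apply Complex.ext
  · simpa using congrFun (congrFun (congrFun hre α) β) γ
  · simpa using congrFun (congrFun (congrFun him α) β) γ

/-- FROM THE POLARISED RELATION.  For a tensor symmetric under the diagonal action of `S_d` the eight-term
relation `(1+X)(1+Y)(1+Z) G = 0` (what polarising `F(x,x,·) = 0`, `x` rank one, literally gives) is twice the
four-term pair-exchange relation. [this cell, NODE-g23 §2] -/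
theorem pairExchange_of_polar {R : Type*} [CommRing R] [NoZeroDivisors R] [CharZero R]
    (G : Word N d → Word N d → Word N d → R)
    (hsymm : ∀ (i j : Fin d) (α β γ : Word N d),
      G (α ∘ ⇑(Equiv.swap i j)) (β ∘ ⇑(Equiv.swap i j)) (γ ∘ ⇑(Equiv.swap i j)) = G α β γ)
    {i j : Fin d} (α β γ : Word N d)
    (h8 : G α β γ + G (α ∘ ⇑(Equiv.swap i j)) β γ + G α (β ∘ ⇑(Equiv.swap i j)) γ
        + G α β (γ ∘ ⇑(Equiv.swap i j))
        + G (α ∘ ⇑(Equiv.swap i j)) (β ∘ ⇑(Equiv.swap i j)) γ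
        + G (α ∘ ⇑(Equiv.swap i j)) β (γ ∘ ⇑(Equiv.swap i j))
        + G α (β ∘ ⇑(Equiv.swap i j)) (γ ∘ ⇑(Equiv.swap i j))
        + G (α ∘ ⇑(Equiv.swap i j)) (β ∘ ⇑(Equiv.swap i j)) (γ ∘ ⇑(Equiv.swap i j)) = 0) :
    G α β γ + G (α ∘ ⇑(Equiv.swap i j)) β γ + G α (β ∘ ⇑(Equiv.swap i j)) γ
      + G α β (γ ∘ ⇑(Equiv.swap i j)) = 0 := by
  have inv : ∀ δ : Word N d, (δ ∘ ⇑(Equiv.swap i j)) ∘ ⇑(Equiv.swap i j) = δ := fun δ => by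
    funext k; simp [Equiv.swap_apply_self]
  have e1 : G (α ∘ ⇑(Equiv.swap i j)) (β ∘ ⇑(Equiv.swap i j)) γ = G α β (γ ∘ ⇑(Equiv.swap i j)) := by
    have := hsymm i j (α ∘ ⇑(Equiv.swap i j)) (β ∘ ⇑(Equiv.swap i j)) γ
    rw [inv, inv] at this
    rw [← this]
  have e2 : G (α ∘ ⇑(Equiv.swap i j)) β (γ ∘ ⇑(Equiv.swap i j)) = G α (β ∘ ⇑(Equiv.swap i j)) γ := by
    have := hsymm i j (α ∘ ⇑(Equiv.swap i j)) β (γ ∘ ⇑(Equiv.swap i j))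
    rw [inv, inv] at this
    rw [← this]
  have e3 : G α (β ∘ ⇑(Equiv.swap i j)) (γ ∘ ⇑(Equiv.swap i j)) = G (α ∘ ⇑(Equiv.swap i j)) β γ := by
    have := hsymm i j α (β ∘ ⇑(Equiv.swap i j)) (γ ∘ ⇑(Equiv.swap i j))
    rw [inv, inv] at this
    rw [← this]
  have e4 : G (α ∘ ⇑(Equiv.swap i j)) (β ∘ ⇑(Equiv.swap i j)) (γ ∘ ⇑(Equiv.swap i j)) = G α β γ :=
    hsymm i j α β γ
  rw [e1, e2, e3, e4] at h8
  have h2 : (2 : R) * (G α β γ + G (α ∘ ⇑(Equiv.swap i j)) β γ + G α (β ∘ ⇑(Equiv.swap i j)) γ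
      + G α β (γ ∘ ⇑(Equiv.swap i j))) = 0 := by
    rw [← h8]; ring
  rcases mul_eq_zero.1 h2 with h | h
  · exact absurd h two_ne_zero
  · exact h


end Summit.MatrixMultiplication.MatrixMultiplication.Theorems.ObstructionDescentPairCasimir
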